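import Literature.Computability.QuantumComplexity.QFTKit
import Literature.Computability.QuantumComplexity.WordCircuit
import Literature.Computability.QuantumComplexity.QFTQubitsPhases
import Literature.Computability.QuantumComplexity.QFTQubitsTensor
import HarnessLib

/-!
# The Clifford+T words of the quantum Fourier transform: the controlled phases by dyadic phase gadgets, the block

Topic `Literature/Computability/QuantumComplexity`. The Fourier stage of Regev's quantum sampler
(Regev 2009, Lemma 3.14: "We now apply the quantum Fourier transform on `ℤ_R^n`", `R = 2^κ`) is the
textbook circuit of `QFTQubits.lean`/`QFTQubitsPhases.lean`: Hadamards and the controlled phases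
`cphase ws j l = diag(e([z_j ∧ z_l ∧ j<l]/2^{l-j+1}))`. The phases are irrational gates; in the tree's
Clifford+`T` model each is REALISED, to dyadic accuracy, by the assembled phase gadget of
`PhaseGadgetAssemblyGen.lean` driven by the dyadic sign predicate `SLP.qftPhaseB k (cosThr m k) (sinThr m k)`
(`DyadicPhaseThresholds.lean`, `m = l − j + 1`), exactly as the AJL controlled phase in
`LetterWord.phaseWord_good`. This file is that instantiation:

* `QFTWord.WiresOK kit ws` — the phase wires `ws : Fin κ ↪ Fin N` are data wires of the gadget kit
  (below the register block, apart from the dummy, the Hadamard wires and the helpers);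
* `QFTWord.insQFT kit ws j l = [kit.d0, ws j, ws l]` (`insQFT_ok`), the flag program `phaseOps`, its flag
  wire and well-formedness, the word `qftPhaseWord` (an OAA word around the phase sandwich) and its error
  `qftPhaseErr k = 9√(2·8/2^k)`;
* **`QFTWord.qftPhaseWord_good`** — for `j < l` the word is a good `ApproxStep` implementing
  `cphase ws j l` on the kit's clean-input condition `kit.P` up to `qftPhaseErr k`
  (`phaseGadget_implOn_gen` with `u = cphaseDiag ws j l`, the entry bound `SLP.qftPhase_entry_bound`
  and `SLP.norm_dyadicPhase_sub_le`).

* the block: `pairWord`/`pairStep` (the phase word for `j < l`, the empty circuit for `l ≤ j`, where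
  `cphase = 1`), `hadWord`/`hadStep` (one exact Hadamard), `roundWords`/`roundSteps`, `blockWords`,
  `blockSteps`, `blockCircuit` (a `chainCircuit`); `blockSteps_map_ideal` (the ideal gates ARE
  `allGates ws`), `toMatrix_blockCircuit`, `blockSteps_good`, `sum_err_blockSteps_le` (`≤ κ²·qftPhaseErr k`),
  `update_mem_P_iff`, and **`QFTWord.blockCircuit_implOn`**: the block circuit implements `blockQFT ws`
  on `kit.P` up to `κ² · qftPhaseErr k` (`ImplOn.listProd`, `prod_allGates`).

Everything here is proved; definitions have bodies; no named fact is introduced. The `n`-block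
composition is `QFTStageImplOn.implOn_multiQFT_of_blocks` (with `blockSteps_map_ideal`, `blockSteps_good`).

## References

* O. Regev, *On lattices, learning with errors, random linear codes, and cryptography*, J. ACM 56
  (2009), art. 34, Lemma 3.14 (proof) and §2, p. 11 (finite precision) [Regev2009].
* M. A. Nielsen, I. L. Chuang, *Quantum Computation and Quantum Information*, CUP 2010, §5.1 Fig. 5.1,
  §4.5.3 [NielsenChuang2010].
* D. W. Berry, A. M. Childs, R. Cleve, R. Kothari, R. D. Somma, STOC 2014, Lemma 3.1 [BerryEtAl2014].
-/

noncomputable section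

namespace Literature.Computability.QuantumComplexity

open Literature.Computability.Complexity (bitsToNat bitsToNat_cons)
open Literature.Computability.Complexity.Com (testBit_bitsToNat)

open _root_.Matrix Finset Cryptography RevSim GadgetKit QFTQubits
open scoped Matrix.Norms.L2Operator

namespace QFTWord

variable {N κ : ℕ}

/-- **Well-placedness of the phase wires** relative to a kit: data wires (below the register block),
apart from the dummy, off the Hadamard wires and the helpers. [folklore] -/
structure WiresOK (kit : GadgetKit N) (ws : Fin κ ↪ Fin N) : Prop where
  /-- phase wires are data wires -/
  lt : ∀ j, (ws j : ℕ) < kit.rb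
  /-- … apart from the dummy -/
  d0 : ∀ j, ws j ≠ kit.d0
  /-- … not Hadamard wires -/
  had : ∀ j, ws j ∉ kit.cr :: kit.as
  /-- … nor helpers -/
  hs : ∀ j, ws j ∉ kit.hs

section Word

variable {kit : GadgetKit N} (hk : kit.OK) {ws : Fin κ ↪ Fin N} (hW : WiresOK kit ws) (j l : Fin κ) (hjl : j < l)

/-- The further inputs of the phase gadget: the dummy, then the two phase wires. [folklore] -/
def insQFT (kit : GadgetKit N) (ws : Fin κ ↪ Fin N) (j l : Fin κ) : List (Fin N) := [kit.d0, ws j, ws l]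

include hk hW hjl in
/-- The inputs are admissible. [folklore] -/
theorem insQFT_ok : (insQFT kit ws j l).Nodup ∧ (∀ i ∈ insQFT kit ws j l, i ∉ kit.cr :: kit.as) ∧
    (∀ i ∈ insQFT kit ws j l, (i : ℕ) < kit.rb) ∧ (insQFT kit ws j l).length ≤ 9 ∧ ∀ i ∈ insQFT kit ws j l, i ∉ kit.hs := by
  have hne : ws j ≠ ws l := fun h => (ne_of_lt hjl) (ws.injective h)
  refine ⟨?_, ?_, ?_, by simp [insQFT], ?_⟩
  · have h1 : kit.d0 ≠ ws j := (hW.d0 j).symm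
    have h2 : kit.d0 ≠ ws l := (hW.d0 l).symm
    simp [insQFT, h1, h2, hne]
  · intro i hi; simp only [insQFT, List.mem_cons, List.not_mem_nil, or_false] at hi
    rcases hi with rfl | rfl | rfl
    exacts [hk.d0_notin, hW.had j, hW.had l]
  · intro i hi; simp only [insQFT, List.mem_cons, List.not_mem_nil, or_false] at hi
    rcases hi with rfl | rfl | rfl
    exacts [hk.d0_lt, hW.lt j, hW.lt l]
  · intro i hi; simp only [insQFT, List.mem_cons, List.not_mem_nil, or_false] at hi
    rcases hi with rfl | rfl | rfl
    exacts [hk.hs_d0, hW.hs j, hW.hs l]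

/-- The phase denominator exponent `m = l − j + 1`. [cite: NielsenChuang2010, §5.1] -/
def mOf (j l : Fin κ) : ℕ := (l : ℕ) - j + 1

/-- The sign program of the phase `e(1/2^m)`. [folklore] -/
def prog (k : ℕ) (j l : Fin κ) : SLP.BExpr := SLP.qftPhaseB k (SLP.cosThr (mOf j l) k) (SLP.sinThr (mOf j l) k)

/-- The flag program of the phase gadget. [folklore] -/
def phaseOps (kit : GadgetKit N) (ws : Fin κ ↪ Fin N) (j l : Fin κ) : List (ClOp (Fin N)) :=
  gadgetOps kit.hN (kit.useLayout (insQFT kit ws j l)) (prog kit.k j l) (Wd := kit.Wd)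

/-- Its flag wire. [folklore] -/
def phaseFlag (kit : GadgetKit N) (ws : Fin κ ↪ Fin N) (j l : Fin κ) : Fin N :=
  gadgetFlag kit.hN (kit.useLayout (insQFT kit ws j l)) (prog kit.k j l) (Wd := kit.Wd)

/-- **The bounds hypothesis**: the kit's register/flag/scratch bounds dominate the program. [folklore] -/
structure ProgOK (kit : GadgetKit N) (j l : Fin κ) : Prop where
  /-- registers -/
  R_ge : ((prog kit.k j l).compile kit.Wd 0 0).2.2.1 ≤ kit.R
  /-- flags -/
  F_ge : ((prog kit.k j l).compile kit.Wd 0 0).2.2.2 ≤ kit.F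
  /-- scratch -/
  T_ge : ((prog kit.k j l).compile kit.Wd 0 0).1.length ≤ kit.T

variable (hP : ProgOK kit j l)

include hk hW hjl hP in
/-- The flag program is well formed. [folklore] -/
theorem phaseOps_wf : ∀ op ∈ phaseOps kit ws j l, op.WF := by
  obtain ⟨hnd, hhad, hlt, hlen, -⟩ := insQFT_ok hk hW j l hjl
  exact gadgetOps_wf (gadgetLayout_useLayout hk hnd hhad hlt hlen) _ (SLP.ok_qftPhaseB kit.k _ _) hP.R_ge hP.F_ge hP.T_ge

/-- **The word of the controlled phase `cphase ws j l`.** [cite: NielsenChuang2010, §5.1] [cite: BerryEtAl2014, Lemma 3.1] -/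
def qftPhaseWord : QCircuit cliffordT N :=
  oaaWordCircuit (phaseSandwichCircuit (kit.cr :: kit.as) (phaseOps kit ws j l) (phaseOps_wf hk hW j l hjl hP) [kit.cr] [phaseFlag kit ws j l])
    (reflectCircuit kit.cr (kit.as ++ kit.region) kit.hs hk.hs_ne (hwfR hk))

/-- The error of one phase word. [folklore] -/
def qftPhaseErr (k : ℕ) : ℝ := 9 * Real.sqrt (2 * (8 / 2 ^ k))

/-- `e(1/2^m) = exp(2πi/2^m)`. [folklore] -/
theorem eR_one_div_two_pow (m : ℕ) : eR (1 / (2 : ℝ) ^ m) = Complex.exp (2 * Real.pi * Complex.I / 2 ^ m) := by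
  unfold eR; congr 1; push_cast; ring

include hk hW hjl hP in
/-- **The phase word is a good step** implementing `cphase ws j l` on `kit.P` (`k ≥ 1`).
[cite: NielsenChuang2010, §5.1 and §4.5.3] [cite: BerryEtAl2014, Lemma 3.1] -/
theorem qftPhaseWord_good (hk1 : 1 ≤ kit.k) :
    (⟨(qftPhaseWord hk hW j l hjl hP).toMatrix 0, cphase ws j l, qftPhaseErr kit.k⟩ : ApproxStep N).Good kit.P := by
  obtain ⟨hnd, hhad, hlt, hlen, hhs⟩ := insQFT_ok hk hW j l hjl
  have G := gadgetLayout_useLayout hk hnd hhad hlt hlen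
  have hok := SLP.ok_qftPhaseB kit.k (SLP.cosThr (mOf j l) kit.k) (SLP.sinThr (mOf j l) kit.k)
  have hR := hP.R_ge; have hF := hP.F_ge; have hT := hP.T_ge
  have hmax := SLP.maxBnd_qftPhaseB_lt kit.k (SLP.cosThr (mOf j l) kit.k) (SLP.sinThr (mOf j l) kit.k)
  -- the unit scalar
  set u : QReg N → ℂ := cphaseDiag ws j l with hu
  have huu : ∀ x, ‖u x‖ = 1 := fun x => norm_cphaseDiag ws j l x
  have hd0 : ∀ x b, u (Function.update x kit.d0 b) = u x := fun x b =>
    cphaseDiag_update ws j l (hW.d0 j).symm (hW.d0 l).symm x b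
  have hd0r : kit.d0 ∉ kit.region := not_mem_region_of_lt hk hk.d0_lt
  -- helpers avoid the sandwich
  have hsw : ∀ h ∈ kit.hs, h ∉ phaseSandwichWires (kit.cr :: kit.as) (phaseOps kit ws j l) [kit.cr] [phaseFlag kit ws j l] := by
    intro h hh hmem
    simp only [phaseSandwichWires, List.mem_append, List.mem_flatMap, List.mem_singleton] at hmem
    rcases hmem with ((hm | ⟨op, hop, hx⟩) | hm) | hm
    · exact hk.hs_had h hh hm
    · rcases mem_of_mem_wiresOf_gadgetOps G _ hok hR hF hT hop hx with hr | hr | hr | hr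
      · exact not_mem_region_of_lt hk (hk.hs_low h hh) hr
      · exact hk.hs_had h hh (List.mem_cons_of_mem _ hr)
      · exact hk.hs_had h hh (by rw [hr]; exact List.mem_cons_self ..)
      · exact hhs _ hr hh
    · exact hk.hs_had h hh (by rw [hm]; exact List.mem_cons_self ..)
    · exact not_mem_region_of_lt hk (hk.hs_low _ hh) (by
        rw [hm]; exact flagW_mem_layoutRegion kit.hN _ (by have := (prog kit.k j l).compile_bounds kit.Wd 0 0; omega))
  -- the flag program never targets the selector wire (input `k`)
  have hrt : ∀ op ∈ phaseOps kit ws j l, op.target ≠ kit.cr := by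
    intro op hop
    have := gadgetOps_target_ne G _ hok hR hF hT (j := kit.k) (by omega) op hop
    rwa [G.iw_c, show finOf N kit.hN (kit.cr : ℕ) = kit.cr from Fin.ext (val_finOf_of_lt kit.hN kit.cr.2)] at this
  -- the implementation bound
  have himpl := phaseGadget_implOn_gen (r := kit.cr) (t := kit.d0) (Fz := phaseFlag kit ws j l) (as := kit.as) (region := kit.region)
    (hs := kit.hs) (phaseOps kit ws j l) (phaseOps_wf hk hW j l hjl hP) hk.nodup hk.d0_notin hd0r hrt
    hk.hs_len hk.hs_ne hk.hs_nodup (hk.hs_had _ · (by simp)) (hls hk) (hlsnd hk) (hwfR hk) hsw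
    (fun rb x n => (prog kit.k j l).eval (2 ^ kit.k * hiNum rb x (insQFT kit ws j l) + n))
    (fun x hx rb n hn => clEval_gadgetOps_flag G _ hok hR hF hmax hT (fun a ha => hx a (by
      rw [layoutRegion_useLayout] at ha; simp only [List.cons_append, List.mem_cons, List.mem_append]; exact Or.inr (Or.inr ha))) rb
      (by rw [hk.len] at hn; exact hn))
    u huu hd0 (show (0 : ℝ) ≤ 8 / 2 ^ kit.k by positivity) (fun x => by
      rw [hk.len]
      have key := SLP.qftPhase_entry_bound kit.k (SLP.cosThr_le (mOf j l) kit.k) (SLP.sinThr_le (mOf j l) kit.k)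
        (eR (1 / (2 : ℝ) ^ mOf j l)) (x kit.d0) (bitsToNat ([ws j, ws l].map x))
      have e1 : ∀ (rb : Bool) (n : ℕ), (prog kit.k j l).eval (2 ^ kit.k * hiNum rb x (insQFT kit ws j l) + n) =
          (SLP.qftPhaseB kit.k (SLP.cosThr (mOf j l) kit.k) (SLP.sinThr (mOf j l) kit.k)).eval
            (2 ^ kit.k * SLP.hiOf rb (x kit.d0) (bitsToNat ([ws j, ws l].map x)) + n) := by
        intro rb n; rw [insQFT, hiNum_cons]; rfl
      have e2 : (SLP.qftCtlB kit.k).eval (2 ^ (kit.k + 2) * bitsToNat ([ws j, ws l].map x)) = (x (ws j) && x (ws l)) := by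
        rw [SLP.qftCtlB_eval_high, List.map, List.map, List.map, testBit_bitsToNat, testBit_bitsToNat]
        rfl
      simp only [e1]
      rw [e2] at key
      have e3 : u x = (if (x (ws j) && x (ws l)) = true then eR (1 / (2 : ℝ) ^ mOf j l) else 1) := by
        simp only [hu, cphaseDiag, Bool.and_eq_true, mOf]
        by_cases h : x (ws j) = true ∧ x (ws l) = true
        · rw [if_pos ⟨h.1, h.2, hjl⟩, if_pos h]
        · rw [if_neg (fun h' => h ⟨h'.1, h'.2.1⟩), if_neg h]
      rw [e3]
      refine key.trans ?_
      have hdy := SLP.norm_dyadicPhase_sub_le (mOf j l) hk1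
      rw [← eR_one_div_two_pow] at hdy
      have : (4 : ℝ) / 2 ^ kit.k + 4 / 2 ^ kit.k = 8 / 2 ^ kit.k := by ring
      rw [← this]
      exact add_le_add le_rfl hdy)
  rw [ctrlGate_smul_one] at himpl
  exact
    { implOn := himpl
      act_contr := isContraction_of_mem_unitaryGroup (QCircuit.toMatrix_mem_unitaryGroup_holds cliffordT_isUnitary_holds 0 _)
      ideal_contr := isContraction_diagonal_of_norm_eq_one huu
      ideal_pres := preservesSupp_diagonal _ _
      err_nonneg := by show (0 : ℝ) ≤ qftPhaseErr kit.k; unfold qftPhaseErr; positivity }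

end Word

/-! ### The block: all rounds, the Hadamards exact -/

section Block

variable {kit : GadgetKit N} (hk : kit.OK) {ws : Fin κ ↪ Fin N} (hW : WiresOK kit ws)
  (hP : ∀ j l : Fin κ, j < l → ProgOK kit j l)

/-- The controlled phase of a pair with `l ≤ j` is the identity. [cite: NielsenChuang2010, §5.1] -/
theorem cphase_eq_one_of_not_lt {j l : Fin κ} (h : ¬ j < l) : cphase ws j l = 1 := by
  unfold cphase
  rw [← Matrix.diagonal_one]
  congr 1
  funext z
  unfold cphaseDiag
  rw [if_neg (fun h' => h h'.2.2)]

/-- **The word of the pair `(j, l)`**: the phase word for `j < l`, the empty circuit otherwise. [folklore] -/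
def pairWord (j l : Fin κ) : QCircuit cliffordT N :=
  if h : j < l then qftPhaseWord hk hW j l h (hP j l h) else ⟨[]⟩

/-- **The step of the pair `(j, l)`.** [folklore] -/
def pairStep (j l : Fin κ) : ApproxStep N :=
  if h : j < l then ⟨(qftPhaseWord hk hW j l h (hP j l h)).toMatrix 0, cphase ws j l, qftPhaseErr kit.k⟩ else ⟨1, cphase ws j l, 0⟩

/-- The ideal gate of a pair step. [folklore] -/
theorem pairStep_ideal (j l : Fin κ) : (pairStep hk hW hP j l).ideal = cphase ws j l := by
  unfold pairStep; split_ifs <;> rfl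

/-- The actual matrix of a pair step is the matrix of its word. [folklore] -/
theorem pairStep_act (j l : Fin κ) : (pairStep hk hW hP j l).act = (pairWord hk hW hP j l).toMatrix 0 := by
  unfold pairStep pairWord; split_ifs <;> simp

/-- The error of a pair step is at most the phase error. [folklore] -/
theorem pairStep_err_le (j l : Fin κ) : (pairStep hk hW hP j l).err ≤ qftPhaseErr kit.k := by
  unfold pairStep; split_ifs
  · exact le_rfl
  · show (0 : ℝ) ≤ qftPhaseErr kit.k; unfold qftPhaseErr; positivity

/-- **The Hadamard word of round `j`** (one exact Clifford gate). [cite: NielsenChuang2010, §5.1] -/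
def hadWord (ws : Fin κ ↪ Fin N) (j : Fin κ) : QCircuit cliffordT N := ⟨[hOn (ws j)]⟩

/-- The Hadamard step (exact). [folklore] -/
def hadStep (ws : Fin κ ↪ Fin N) (j : Fin κ) : ApproxStep N := ⟨(hadWord ws j).toMatrix 0, (hOn (ws j)).toMatrix 0, 0⟩

/-- The matrix of the Hadamard word. [folklore] -/
theorem toMatrix_hadWord (ws : Fin κ ↪ Fin N) (j : Fin κ) : (hadWord ws j).toMatrix 0 = (hOn (ws j)).toMatrix 0 := by
  rw [hadWord, QCircuit.toMatrix_cons, QCircuit.toMatrix_nil, one_mul]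

/-- The words of round `j`: the pairs in increasing `l`, then the Hadamard (applied first). [cite: NielsenChuang2010, §5.1 Fig. 5.1] -/
def roundWords (j : Fin κ) : List (QCircuit cliffordT N) := (List.ofFn fun l => pairWord hk hW hP j l) ++ [hadWord ws j]

/-- The steps of round `j`. [folklore] -/
def roundSteps (j : Fin κ) : List (ApproxStep N) := (List.ofFn fun l => pairStep hk hW hP j l) ++ [hadStep ws j]

/-- **The words of the block** (last round first in the list = applied last). [folklore] -/
def blockWords : List (QCircuit cliffordT N) := ((List.ofFn (roundWords hk hW hP)).reverse).flatten

/-- **The steps of the block.** [folklore] -/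
def blockSteps : List (ApproxStep N) := ((List.ofFn (roundSteps hk hW hP)).reverse).flatten

/-- **The circuit of the block.** [cite: NielsenChuang2010, §5.1 Fig. 5.1] -/
def blockCircuit : QCircuit cliffordT N := chainCircuit (blockWords hk hW hP)

/-- **The ideal gates of the block's steps are the QFT's gate list** `allGates ws`. [cite: NielsenChuang2010, §5.1] -/
theorem blockSteps_map_ideal : (blockSteps hk hW hP).map ApproxStep.ideal = allGates ws := by
  rw [blockSteps, List.map_flatten, List.map_reverse, List.map_ofFn, allGates]
  congr 2
  refine List.ofFn_inj.2 (funext fun j => ?_)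
  rw [Function.comp_apply, roundSteps, roundGates, List.map_append, List.map_ofFn, List.map_singleton]
  congr 1
  · exact List.ofFn_inj.2 (funext fun l => pairStep_ideal hk hW hP j l)

/-- The actual matrices of the block's steps are the matrices of its words. [folklore] -/
theorem blockSteps_map_act : (blockSteps hk hW hP).map ApproxStep.act = (blockWords hk hW hP).map (QCircuit.toMatrix 0) := by
  rw [blockSteps, blockWords, List.map_flatten, List.map_flatten, List.map_reverse, List.map_reverse, List.map_ofFn, List.map_ofFn]
  congr 2
  refine List.ofFn_inj.2 (funext fun j => ?_)
  rw [Function.comp_apply, Function.comp_apply, roundSteps, roundWords, List.map_append, List.map_append, List.map_ofFn, List.map_ofFn,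
    List.map_singleton, List.map_singleton]
  congr 1
  · exact List.ofFn_inj.2 (funext fun l => pairStep_act hk hW hP j l)

/-- **The matrix of the block circuit is the product of the actual steps.** [folklore] -/
theorem toMatrix_blockCircuit : (blockCircuit hk hW hP).toMatrix 0 = ((blockSteps hk hW hP).map ApproxStep.act).prod := by
  rw [blockCircuit, toMatrix_chainCircuit, blockSteps_map_act]

/-- **Every step of the block is an implementation by a contraction with a nonnegative error** (`k ≥ 1`).
[cite: NielsenChuang2010, §4.5.3] [cite: BerryEtAl2014, Lemma 3.1] -/
theorem blockSteps_good (hk1 : 1 ≤ kit.k) :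
    ∀ s ∈ blockSteps hk hW hP, ImplOn kit.P s.act s.ideal s.err ∧ IsContraction s.act ∧ 0 ≤ s.err := by
  intro s hs
  rw [blockSteps, List.mem_flatten] at hs
  obtain ⟨L, hL, hsL⟩ := hs
  rw [List.mem_reverse, List.mem_ofFn] at hL
  obtain ⟨j, rfl⟩ := hL
  rw [roundSteps, List.mem_append, List.mem_ofFn, List.mem_singleton] at hsL
  rcases hsL with ⟨l, rfl⟩ | rfl
  · by_cases h : j < l
    · have hg := qftPhaseWord_good hk hW j l h (hP j l h) hk1
      have e : pairStep hk hW hP j l = ⟨(qftPhaseWord hk hW j l h (hP j l h)).toMatrix 0, cphase ws j l, qftPhaseErr kit.k⟩ := by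
        unfold pairStep; rw [dif_pos h]
      rw [e]
      exact ⟨hg.implOn, hg.act_contr, hg.err_nonneg⟩
    · have e : pairStep hk hW hP j l = ⟨1, cphase ws j l, 0⟩ := by unfold pairStep; rw [dif_neg h]
      rw [e]
      exact ⟨ImplOn.of_eq kit.P (cphase_eq_one_of_not_lt h).symm, isContraction_one, le_rfl⟩
  · refine ⟨?_, ?_, le_rfl⟩
    · show ImplOn kit.P ((hadWord ws j).toMatrix 0) ((hOn (ws j)).toMatrix 0) 0
      exact ImplOn.of_eq kit.P (toMatrix_hadWord ws j)
    · exact isContraction_of_mem_unitaryGroup (QCircuit.toMatrix_mem_unitaryGroup_holds cliffordT_isUnitary_holds 0 _)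

/-- **The total error of the block** is at most `κ² · qftPhaseErr k`. [folklore] -/
theorem sum_err_blockSteps_le : ((blockSteps hk hW hP).map ApproxStep.err).sum ≤ κ * κ * qftPhaseErr kit.k := by
  have hround : ∀ j, ((roundSteps hk hW hP j).map ApproxStep.err).sum ≤ κ * qftPhaseErr kit.k := by
    intro j
    rw [roundSteps, List.map_append, List.sum_append, List.map_ofFn, List.sum_ofFn, List.map_singleton, List.sum_singleton]
    calc ∑ l : Fin κ, (ApproxStep.err ∘ fun l => pairStep hk hW hP j l) l + (hadStep ws j).err
        ≤ ∑ _l : Fin κ, qftPhaseErr kit.k + 0 := add_le_add (sum_le_sum fun l _ => pairStep_err_le hk hW hP j l) le_rfl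
      _ = κ * qftPhaseErr kit.k := by rw [sum_const, card_univ, Fintype.card_fin, nsmul_eq_mul, add_zero]
  simp only [blockSteps, List.map_flatten, List.sum_flatten, List.map_reverse, List.sum_reverse, List.map_ofFn, List.sum_ofFn,
    Function.comp_apply]
  calc ∑ j : Fin κ, ((roundSteps hk hW hP j).map ApproxStep.err).sum ≤ ∑ _j : Fin κ, (κ : ℝ) * qftPhaseErr kit.k :=
        sum_le_sum fun j _ => hround j
    _ = κ * κ * qftPhaseErr kit.k := by rw [sum_const, card_univ, Fintype.card_fin, nsmul_eq_mul]; ring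

include hk in
/-- **The kit's clean-input condition ignores the phase wires.** [folklore] -/
theorem update_mem_P_iff (hW : WiresOK kit ws) (j : Fin κ) (x : QReg N) (b : Bool) : Function.update x (ws j) b ∈ kit.P ↔ x ∈ kit.P := by
  have h1 : ws j ∉ kit.cr :: kit.as ++ kit.region := by
    rw [List.cons_append, List.mem_cons, List.mem_append, not_or, not_or]
    have := hW.had j
    rw [List.mem_cons, not_or] at this
    exact ⟨this.1, this.2, not_mem_region_of_lt hk (hW.lt j)⟩
  unfold GadgetKit.P
  rw [Set.mem_inter_iff, Set.mem_inter_iff, update_mem_cleanOn_iff h1, update_mem_cleanOn_iff (hW.hs j)]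

/-- **The Fourier block implements the one-register QFT** on the kit's clean-input condition up to
`κ² · qftPhaseErr k` (`k ≥ 1`). [cite: Regev2009, Lemma 3.14 (proof)] [cite: NielsenChuang2010, §5.1 and §4.5.3] -/
theorem blockCircuit_implOn (hk1 : 1 ≤ kit.k) :
    ImplOn kit.P ((blockCircuit hk hW hP).toMatrix 0) (blockQFT ws) (κ * κ * qftPhaseErr kit.k) := by
  have hgood : ∀ s ∈ blockSteps hk hW hP, s.Good kit.P := by
    intro s hs
    obtain ⟨h1, h2, h3⟩ := blockSteps_good hk hW hP hk1 s hs
    have hideal : s.ideal ∈ allGates ws := by rw [← blockSteps_map_ideal hk hW hP]; exact List.mem_map_of_mem hs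
    exact ⟨h1, h2, isContraction_of_mem_unitaryGroup (allGates_mem_unitaryGroup ws _ hideal),
      preservesSupp_allGates ws (fun j => update_mem_P_iff hk hW j) _ hideal, h3⟩
  have h := ImplOn.listProd hgood
  rw [← toMatrix_blockCircuit, blockSteps_map_ideal, prod_allGates] at h
  exact h.mono (sum_err_blockSteps_le hk hW hP)

end Block

end QFTWord

end Literature.Computability.QuantumComplexity

end
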